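import Mathlib.Topology.Order.Compact
import Literature.Geometry.Riemannian.ConformallyCompactFilling
import HarnessLib

/-!
# Topology of conformally compact fillings: the defining function tends to zero at infinity of
# the bulk, and decaying continuous functions on the bulk attain their maximum

Topic `Geometry/Riemannian`; everything is PROVED (no definition, no named fact). Support file for
the named fact `Literature.Geometry.Riemannian.liQingShi_pinching_five` (Li–Qing–Shi 2017,
Thm. 1.8 at bulk dimension `n = 5`, `LiQingShiPinching.lean`). Step 1 of its printed proof
(arXiv:1410.6402, pp. 12–13) picks, on each conformally compact Einstein manifold of a
contradicting sequence, a point where the Weyl norm is MAXIMAL: "Since `|W|[g⁺_j](p) → 0` as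
`p → ∞` on each conformally compact Einstein manifold `(Xⁿ_j, g⁺_j)`, there exists a point
`p_j ∈ Xⁿ_j` so that `τ_j = |W|[g⁺_j](p_j) = max_{p ∈ Xⁿ_j} |W|[g⁺_j](p)`." Two things are packed
into "`p → ∞`" and "there exists": (i) on the interior `N ≅ X̄ ∖ ∂X̄` of the compactification,
"`p → ∞`" is the co-compact filter of `N`, along which the defining function `ρ` tends to `0`
(because `{ρ ≥ η}` is a compact subset of the interior for every `η > 0`); (ii) a continuous
function on `N` tending to `0` at infinity attains its maximum (extreme value theorem away from
compact sets). Both are proved here, in the vocabulary of `IsConformallyCompactFillingOfDim`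
(`ConformallyCompactFilling.lean`: compactification `X̄` with boundary, smooth embedding
`j : N → X̄` onto the interior, smooth defining function `ρ ≥ 0` vanishing exactly on `∂X̄`):

* `isCompact_setOf_le_comp_of_isEmbedding` — for a topological embedding `j : N → X` into a
  compact space and a continuous `ρ : X → ℝ` which is positive only on `range j`, the sets
  `{x ∈ N | η ≤ ρ (j x)}` (`η > 0`) are compact;
* `tendsto_comp_cocompact_of_isEmbedding` — hence `ρ ∘ j → 0` along `cocompact N` (for `ρ ≥ 0`);
* `tendsto_cocompact_zero_of_abs_le_mul_sq` — a function with `|f| ≤ C (ρ ∘ j)²` tends to `0`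
  along `cocompact N` (the shape of the curvature decay `|W[g⁺]| ≤ C ρ²`, Li–Qing–Shi 2017,
  Lemma 1.6);
* `exists_forall_le_of_tendsto_cocompact_zero` — **a continuous nonnegative function on a nonempty
  space tending to `0` at infinity attains its maximum** (Mathlib's `Continuous.exists_forall_ge'`
  at a point where `f > 0`, or trivially if `f ≡ 0`);
* `tendsto_definingFunction_comp_cocompact` — **for the data of a conformally compact filling**
  (`j` a `C^∞` embedding of `N` onto `(𝓡∂ (n+1)).interior X̄`, `X̄` compact, `ρ` smooth, `ρ ≥ 0`,
  `ρ = 0 ↔ ∂X̄`): `ρ ∘ j → 0` along `cocompact N`, and `isCompact_setOf_le_definingFunction_comp`;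
* `exists_isMaxOn_of_abs_le_mul_definingFunction_sq` — **Step 1's "there exists a point `p_j`"**:
  for such data, every continuous `f ≥ 0` on a nonempty bulk `N` with `|f| ≤ C (ρ ∘ j)²` attains
  its maximum on `N`;
* `IsConformallyCompactFillingOfDim.exists_compactification_tendsto`,
  `IsConformallyCompactFilling.exists_compactification_tendsto` — the package re-exported with the
  limit `ρ ∘ j → 0` at infinity and the conformal relation `j^*ḡ = (ρ ∘ j)² g` kept, which is the
  form in which the decay-and-maximum step consumes it.

## References

* G. Li, J. Qing, Y. Shi, *Gap phenomena and curvature estimates for conformally compact Einstein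
  manifolds*, Trans. Amer. Math. Soc. 369 (2017) 4385–4413 (arXiv:1410.6402): Def. 2.1 (p. 6),
  Lemma 1.6 (p. 4), proof of Thm. 1.8, Step 1 (pp. 12–13). [LiQingShi2017]
-/

noncomputable section

open Set Filter Topology
open scoped Manifold ContDiff

namespace Literature.Geometry.Riemannian

/-! ### Point-set topology: an embedding onto the positivity set of a function on a compact space -/

section Topology

variable {N X : Type*} [TopologicalSpace N] [TopologicalSpace X]

/-- If `j : N → X` is a topological embedding into a compact space and the continuous function
`ρ : X → ℝ` is positive only on `range j`, then `{x ∈ N | η ≤ ρ (j x)}` is compact for every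
`η > 0`: it is the preimage of the compact set `{η ≤ ρ} ⊆ range j`. [folklore] -/
theorem isCompact_setOf_le_comp_of_isEmbedding [CompactSpace X] {j : N → X} (hj : IsEmbedding j)
    {ρ : X → ℝ} (hρ : Continuous ρ) (hpos : ∀ y, 0 < ρ y → y ∈ range j) {η : ℝ} (hη : 0 < η) :
    IsCompact {x : N | η ≤ ρ (j x)} := by
  have hc : IsCompact {y : X | η ≤ ρ y} := (isClosed_le continuous_const hρ).isCompact
  have hsub : {y : X | η ≤ ρ y} ⊆ range j := fun y hy ↦ hpos y (hη.trans_le hy)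
  exact hj.isInducing.isCompact_preimage' hc hsub

/-- Under the same hypotheses and `ρ ≥ 0`: **`ρ ∘ j → 0` at infinity of `N`** (along the
co-compact filter). [folklore] -/
theorem tendsto_comp_cocompact_of_isEmbedding [CompactSpace X] {j : N → X} (hj : IsEmbedding j)
    {ρ : X → ℝ} (hρ : Continuous ρ) (hρ0 : ∀ y, 0 ≤ ρ y) (hpos : ∀ y, 0 < ρ y → y ∈ range j) :
    Tendsto (fun x ↦ ρ (j x)) (cocompact N) (𝓝 0) := by
  rw [Metric.tendsto_nhds]
  intro ε hε
  rw [Filter.eventually_iff, Filter.mem_cocompact]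
  refine ⟨{x : N | ε ≤ ρ (j x)}, isCompact_setOf_le_comp_of_isEmbedding hj hρ hpos hε, ?_⟩
  intro x hx
  simp only [mem_compl_iff, mem_setOf_eq, not_le] at hx
  simp only [mem_setOf_eq, Real.dist_eq, sub_zero, abs_of_nonneg (hρ0 (j x))]
  exact hx

/-- A function dominated by `C (ρ ∘ j)²` with `ρ ∘ j → 0` at infinity tends to `0` at infinity —
the shape of the curvature decay `|W[g⁺]| ≤ C₀ ρ²` of a conformally compact metric (Li–Qing–Shi
2017, Lemma 1.6). [cite: LiQingShi2017, Lemma 1.6 (p. 4)] -/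
theorem tendsto_cocompact_zero_of_abs_le_mul_sq {σ f : N → ℝ} {C : ℝ}
    (hσ : Tendsto σ (cocompact N) (𝓝 0)) (hf : ∀ x, |f x| ≤ C * σ x ^ 2) :
    Tendsto f (cocompact N) (𝓝 0) := by
  have h2 : Tendsto (fun x ↦ C * σ x ^ 2) (cocompact N) (𝓝 0) := by
    have := (hσ.pow 2).const_mul C
    simpa using this
  exact squeeze_zero_norm (fun x ↦ by simpa [Real.norm_eq_abs] using hf x) h2

/-- **Extreme value theorem at infinity**: a continuous nonnegative function on a nonempty space
which tends to `0` along the co-compact filter attains its maximum (at a point `x₀` with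
`f x₀ > 0` the set `{f ≥ f x₀}` avoids a neighbourhood of infinity, `Continuous.exists_forall_ge'`;
if `f ≡ 0` every point is a maximum). [folklore] -/
theorem exists_forall_le_of_tendsto_cocompact_zero [Nonempty N] {f : N → ℝ} (hf : Continuous f)
    (hf0 : ∀ x, 0 ≤ f x) (hlim : Tendsto f (cocompact N) (𝓝 0)) : ∃ x, ∀ y, f y ≤ f x := by
  by_cases hex : ∃ x₀, 0 < f x₀
  · obtain ⟨x₀, hx₀⟩ := hex
    refine hf.exists_forall_ge' x₀ ?_
    have hev : ∀ᶠ x in cocompact N, f x < f x₀ :=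
      (Metric.tendsto_nhds.1 hlim) (f x₀) hx₀ |>.mono fun x hx ↦ by
        rw [Real.dist_eq, sub_zero, abs_of_nonneg (hf0 x)] at hx
        exact hx
    exact hev.mono fun x hx ↦ hx.le
  · push Not at hex
    inhabit N
    exact ⟨default, fun y ↦ (le_antisymm (hex y) (hf0 y)).symm ▸ hf0 default⟩

/-- **A decaying continuous nonnegative function attains its maximum**: `f` continuous, `f ≥ 0`,
`|f| ≤ C (ρ ∘ j)²` with `ρ ∘ j → 0` at infinity, `N` nonempty. [folklore] -/
theorem exists_forall_le_of_abs_le_mul_sq [Nonempty N] {σ f : N → ℝ} {C : ℝ} (hf : Continuous f)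
    (hf0 : ∀ x, 0 ≤ f x) (hσ : Tendsto σ (cocompact N) (𝓝 0)) (hfC : ∀ x, |f x| ≤ C * σ x ^ 2) :
    ∃ x, ∀ y, f y ≤ f x :=
  exists_forall_le_of_tendsto_cocompact_zero hf hf0 (tendsto_cocompact_zero_of_abs_le_mul_sq hσ hfC)

end Topology

/-! ### The compactification data of a conformally compact filling -/

section Filling

variable {n : ℕ} {N : Type*} [TopologicalSpace N] [ChartedSpace (EuclideanSpace ℝ (Fin (n + 1))) N]
  {X : Type*} [TopologicalSpace X] [ChartedSpace (EuclideanHalfSpace (n + 1)) X]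

omit [TopologicalSpace N] [ChartedSpace (EuclideanSpace ℝ (Fin (n + 1))) N] in
/-- For the data of a conformally compact filling — `j` a smooth embedding of the bulk `N` onto the
interior of the compactification `X̄` and a defining function `ρ` vanishing exactly on `∂X̄` —
`ρ` is positive exactly on `range j`. [cite: LiQingShi2017, Def. 2.1 (p. 6)] -/
theorem definingFunction_pos_iff_mem_range {j : N → X} (hjr : range j = (𝓡∂ (n + 1)).interior X)
    {ρ : X → ℝ} (hρ0 : ∀ y, 0 ≤ ρ y) (hρb : ∀ y, ρ y = 0 ↔ y ∈ (𝓡∂ (n + 1)).boundary X) (y : X) :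
    0 < ρ y ↔ y ∈ range j := by
  rw [hjr, ← ModelWithCorners.compl_boundary, mem_compl_iff, ← hρb y]
  exact ⟨fun h h0 ↦ h.ne' h0, fun h ↦ lt_of_le_of_ne (hρ0 y) (Ne.symm h)⟩

/-- **`{ρ ∘ j ≥ η}` is a compact subset of the bulk** (`η > 0`), for the data of a conformally
compact filling with compact `X̄`. [cite: LiQingShi2017, Def. 2.1 (p. 6)] -/
theorem isCompact_setOf_le_definingFunction_comp [CompactSpace X] {j : N → X}
    (hj : Manifold.IsSmoothEmbedding (𝓡 (n + 1)) (𝓡∂ (n + 1)) ∞ j)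
    (hjr : range j = (𝓡∂ (n + 1)).interior X) {ρ : X → ℝ}
    (hρ : ContMDiff (𝓡∂ (n + 1)) 𝓘(ℝ, ℝ) ∞ ρ) (hρ0 : ∀ y, 0 ≤ ρ y)
    (hρb : ∀ y, ρ y = 0 ↔ y ∈ (𝓡∂ (n + 1)).boundary X) {η : ℝ} (hη : 0 < η) :
    IsCompact {x : N | η ≤ ρ (j x)} :=
  isCompact_setOf_le_comp_of_isEmbedding hj.isEmbedding hρ.continuous
    (fun y hy ↦ (definingFunction_pos_iff_mem_range hjr hρ0 hρb y).1 hy) hη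

/-- **The defining function tends to zero at infinity of the bulk**: for the data of a conformally
compact filling with compact `X̄`, `ρ ∘ j → 0` along `cocompact N` — the meaning of "`p → ∞`" on a
conformally compact manifold. [cite: LiQingShi2017, Def. 2.1 (p. 6)] -/
theorem tendsto_definingFunction_comp_cocompact [CompactSpace X] {j : N → X}
    (hj : Manifold.IsSmoothEmbedding (𝓡 (n + 1)) (𝓡∂ (n + 1)) ∞ j)
    (hjr : range j = (𝓡∂ (n + 1)).interior X) {ρ : X → ℝ}
    (hρ : ContMDiff (𝓡∂ (n + 1)) 𝓘(ℝ, ℝ) ∞ ρ) (hρ0 : ∀ y, 0 ≤ ρ y)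
    (hρb : ∀ y, ρ y = 0 ↔ y ∈ (𝓡∂ (n + 1)).boundary X) :
    Tendsto (fun x ↦ ρ (j x)) (cocompact N) (𝓝 0) :=
  tendsto_comp_cocompact_of_isEmbedding hj.isEmbedding hρ.continuous hρ0
    fun y hy ↦ (definingFunction_pos_iff_mem_range hjr hρ0 hρb y).1 hy

/-- **Step 1's "there exists a point `p_j` with `|W|(p_j) = max |W|`"** (Li–Qing–Shi 2017, proof
of Thm. 1.8, pp. 12–13), in the abstract: for the data of a conformally compact filling with compact
`X̄` and nonempty bulk `N`, every continuous `f ≥ 0` on `N` with the decay `|f| ≤ C (ρ ∘ j)²`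
(the shape of Lemma 1.6, `|W[g⁺]| ≤ C₀ ρ²`) attains its maximum.
[cite: LiQingShi2017, Thm. 1.8 (proof, Step 1, pp. 12–13) and Lemma 1.6 (p. 4)] -/
theorem exists_forall_le_of_abs_le_mul_definingFunction_sq [CompactSpace X] [Nonempty N]
    {j : N → X} (hj : Manifold.IsSmoothEmbedding (𝓡 (n + 1)) (𝓡∂ (n + 1)) ∞ j)
    (hjr : range j = (𝓡∂ (n + 1)).interior X) {ρ : X → ℝ}
    (hρ : ContMDiff (𝓡∂ (n + 1)) 𝓘(ℝ, ℝ) ∞ ρ) (hρ0 : ∀ y, 0 ≤ ρ y)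
    (hρb : ∀ y, ρ y = 0 ↔ y ∈ (𝓡∂ (n + 1)).boundary X)
    {f : N → ℝ} (hf : Continuous f) (hf0 : ∀ x, 0 ≤ f x) {C : ℝ}
    (hfC : ∀ x, |f x| ≤ C * ρ (j x) ^ 2) :
    ∃ x, ∀ y, f y ≤ f x :=
  exists_forall_le_of_abs_le_mul_sq hf hf0
    (tendsto_definingFunction_comp_cocompact hj hjr hρ hρ0 hρb) hfC

end Filling

/-! ### Re-export of the package with the limit of the defining function -/

section Package

/-- **A conformally compact filling, opened with `ρ ∘ j → 0` at infinity**: the compactification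
data of `IsConformallyCompactFillingOfDim n M g₀ N g` together with the facts the decay step
uses — `j` a smooth embedding onto the interior, `ρ ∘ j → 0` along `cocompact N`, compactness of
`{ρ ∘ j ≥ η}`, `0 < ρ ∘ j`, and the conformal relation `ḡ(dj v, dj w) = ρ(j x)² g(v, w)`.
[cite: LiQingShi2017, Def. 2.1 (p. 6)] -/
theorem IsConformallyCompactFillingOfDim.exists_compactification_tendsto {n : ℕ} {M : Type}
    [TopologicalSpace M] [ChartedSpace (EuclideanSpace ℝ (Fin n)) M] [IsManifold (𝓡 n) ∞ M]
    {g₀ : Bundle.ContMDiffRiemannianMetric (𝓡 n) ∞ (EuclideanSpace ℝ (Fin n))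
      (TangentSpace (𝓡 n) : M → Type _)}
    {N : Type} [TopologicalSpace N] [ChartedSpace (EuclideanSpace ℝ (Fin (n + 1))) N]
    [IsManifold (𝓡 (n + 1)) ∞ N]
    {g : Bundle.ContMDiffRiemannianMetric (𝓡 (n + 1)) ∞ (EuclideanSpace ℝ (Fin (n + 1)))
      (TangentSpace (𝓡 (n + 1)) : N → Type _)}
    (h : IsConformallyCompactFillingOfDim n M g₀ N g) :
    ∃ (X : Type) (_ : TopologicalSpace X) (_ : T2Space X) (_ : SecondCountableTopology X)
      (_ : ChartedSpace (EuclideanHalfSpace (n + 1)) X) (_ : IsManifold (𝓡∂ (n + 1)) ∞ X)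
      (_ : CompactSpace X) (j : N → X) (ρ : X → ℝ)
      (gb : Bundle.ContMDiffRiemannianMetric (𝓡∂ (n + 1)) 2 (EuclideanSpace ℝ (Fin (n + 1)))
        (TangentSpace (𝓡∂ (n + 1)) : X → Type _)),
      Manifold.IsSmoothEmbedding (𝓡 (n + 1)) (𝓡∂ (n + 1)) ∞ j ∧
      range j = (𝓡∂ (n + 1)).interior X ∧
      ContMDiff (𝓡∂ (n + 1)) 𝓘(ℝ, ℝ) ∞ ρ ∧
      (∀ x : N, 0 < ρ (j x)) ∧
      Tendsto (fun x ↦ ρ (j x)) (cocompact N) (𝓝 0) ∧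
      (∀ η : ℝ, 0 < η → IsCompact {x : N | η ≤ ρ (j x)}) ∧
      (∀ (x : N) (v w : TangentSpace (𝓡 (n + 1)) x),
        gb.inner (j x) (mfderiv (𝓡 (n + 1)) (𝓡∂ (n + 1)) j x v)
          (mfderiv (𝓡 (n + 1)) (𝓡∂ (n + 1)) j x w) = ρ (j x) ^ 2 * g.inner x v w) := by
  obtain ⟨X, _, _, _, _, _, _, _, j, ι, ρ, gb, hj, hjr, -, -, hρ, hρ0, hρb, -, hconf, -⟩ := h
  refine ⟨X, inferInstance, inferInstance, inferInstance, inferInstance, inferInstance,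
    inferInstance, j, ρ, gb, hj, hjr, hρ, fun x ↦ ?_,
    tendsto_definingFunction_comp_cocompact hj hjr hρ hρ0 hρb,
    fun η hη ↦ isCompact_setOf_le_definingFunction_comp hj hjr hρ hρ0 hρb hη, hconf⟩
  exact (definingFunction_pos_iff_mem_range hjr hρ0 hρb (j x)).2 (mem_range_self x)

/-- The same for the dimension-four predicate `IsConformallyCompactFilling` (bulk `N⁵`,
boundary `M⁴`), the package of `liQingShi_pinching_five`. [cite: LiQingShi2017, Def. 2.1 (p. 6)] -/
theorem IsConformallyCompactFilling.exists_compactification_tendsto {M : Type}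
    [TopologicalSpace M] [ChartedSpace (EuclideanSpace ℝ (Fin 4)) M] [IsManifold (𝓡 4) ∞ M]
    {g₀ : Bundle.ContMDiffRiemannianMetric (𝓡 4) ∞ (EuclideanSpace ℝ (Fin 4))
      (TangentSpace (𝓡 4) : M → Type _)}
    {N : Type} [TopologicalSpace N] [ChartedSpace (EuclideanSpace ℝ (Fin 5)) N]
    [IsManifold (𝓡 5) ∞ N]
    {g : Bundle.ContMDiffRiemannianMetric (𝓡 5) ∞ (EuclideanSpace ℝ (Fin 5))
      (TangentSpace (𝓡 5) : N → Type _)}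
    (h : IsConformallyCompactFilling M g₀ N g) :
    ∃ (X : Type) (_ : TopologicalSpace X) (_ : T2Space X) (_ : SecondCountableTopology X)
      (_ : ChartedSpace (EuclideanHalfSpace 5) X) (_ : IsManifold (𝓡∂ 5) ∞ X)
      (_ : CompactSpace X) (j : N → X) (ρ : X → ℝ)
      (gb : Bundle.ContMDiffRiemannianMetric (𝓡∂ 5) 2 (EuclideanSpace ℝ (Fin 5))
        (TangentSpace (𝓡∂ 5) : X → Type _)),
      Manifold.IsSmoothEmbedding (𝓡 5) (𝓡∂ 5) ∞ j ∧
      range j = (𝓡∂ 5).interior X ∧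
      ContMDiff (𝓡∂ 5) 𝓘(ℝ, ℝ) ∞ ρ ∧
      (∀ x : N, 0 < ρ (j x)) ∧
      Tendsto (fun x ↦ ρ (j x)) (cocompact N) (𝓝 0) ∧
      (∀ η : ℝ, 0 < η → IsCompact {x : N | η ≤ ρ (j x)}) ∧
      (∀ (x : N) (v w : TangentSpace (𝓡 5) x),
        gb.inner (j x) (mfderiv (𝓡 5) (𝓡∂ 5) j x v) (mfderiv (𝓡 5) (𝓡∂ 5) j x w) =
          ρ (j x) ^ 2 * g.inner x v w) :=
  IsConformallyCompactFillingOfDim.exists_compactification_tendsto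
    ((isConformallyCompactFilling_iff_ofDim).1 h)

end Package

end Literature.Geometry.Riemannian
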